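import Summits.QuantumFields.YangMills.Theorems.BalabanUVNodesN07SectBExpansionAtObjects
import Summits.QuantumFields.YangMills.Theorems.BalabanUVNodesN07FlatHessianCurlCurlAdapter
import Summits.QuantumFields.YangMills.Theorems.UnitScaleTiltProp8FlatHCurlCurl
import Summits.QuantumFields.YangMills.Theorems.BalabanUVNodesN07AvoidanceAtFlatData
import HarnessLib

/-!
# N07 [B11] — [Balaban1985Variational] **(157) AT NODE 00's RECORD OPERATORS**: the Wilson action in the coordinates of the chart (47), `U₁ = exp(A′ − H·D)`, IS
# `½⟨A′, Δ(1)A′⟩ + ½⟨D, M D⟩ − ⟨QA′, M D⟩ + V₀(A′ − HD)` with `M = (QGQ*)⁻¹ − a` — S1's `Δ_1 = hessOpAt η 1`, lit-balaban's flat `Q`, `H = GQ*(QGQ*)⁻¹`,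
# `(QGQ*)⁻¹ − a` read on matrix fields, pv27's third-order remainder `V₀ = Σ_p ρ_p`

Cell `pub-ymgap` (HUMAN RULING D-0062 ∕ D-0149), Track A node N07 = [Balaban1985Variational]; width seat `pub-ymgap-dag-n07-w1` (g6), lane S1∕D4.
`--kind proof --supports stmt-QuantumFields-27364 --as helper` (K1⁹; count-neutral).  [15] = [Balaban1985Variational]; [5] = [Balaban1985BackgroundPropagators];
[B6] = [Balaban1984PropagatorsII].

WHY.  k0-s1-w2's W-slot capstone (`…K0Stub1SectFWSlotAtRecordSocket`, p621022) certifies Sect. F's `W` for the functional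
`V = ½B(D, M_V·D) − B(QA, M_V·D) + V₀(A − H·D)` and says (HONEST SCOPE (3)): «whether `V` with (`Q`, `H`, `MV`, `Dfun`) IS Sect. F's functional at the record is road R0′'s
(87)∕(128) junction — NOT asserted».  Print's (157) p. 302 is that identity.  This file proves it at NODE 00's objects for lit-balaban's flat operators of ANY nested family
`D` ([B6] Sect. A: `Q = QE D`, `H = hOp (GE D) (QsE D) (EE D)`, `M = EE D − aE D w`) and S1's Hessian of record: the two operator letters it rests on are UST's (137)
`∂*∂H = Q*((QGQ*)⁻¹ − a)` (`FlatHCurlCurl.curlCurl_hOp`: `Δ_aH = Q*(QGQ*)⁻¹`, `R∂*H = 0`, `QH = 1`) and dag-n07-w1's flat (26) expansion (`J(1) = 0`, `𝔄(1) = 0`).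

WHAT IS PROVED (sorry-free; no definition; axioms standard; `M = M_N(ℂ)`; Frobenius pairing `⟨X, Y⟩_F := Σ Re tr(Xᴴ Y)`).
* §1 THE FLAT (26): `cfgGL_one`, `J_cfgGL_one` ((28)'s current VANISHES at `U₀ = 1`: `D^{η*}_1 ∂1 = 0`, `B10Eq68TorusRegularity.covDivT_one`), `bondPair_zero_right`,
  ★★ `wilsonAction4_expChart_one_expansion_hessOpAt` — **`𝔄(exp X) = ½⟪X, Δ_1X⟫ + Σ_p Re ρ_p(A_X)`** (`A_X = hermLetter η 1 X = (iη)⁻¹X`; g0's expansion at `U₀ = 1` with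
  `𝔄(1) = 0` (`N07AvoidanceAtFlatData.wilsonAction4_one`, cited), `⟨A, J(1)⟩ = 0`).
* §2 THE OPERATOR LETTERS ([15] (137) ∕ [B6] (2.19), (2.34)–(2.35)): ★ `inner_curlCurl_hOp` — `⟪x, ∂*∂(HB)⟫ = ⟪Qx, (QGQ*)⁻¹B⟫ − ⟪Qx, aB⟫` for EVERY `x` (no slice needed:
  `H` is Landau); ★ `inner_hOp_curlCurl_hOp` — `⟪HB, ∂*∂(HB)⟫ = ⟪B, (QGQ*)⁻¹B⟫ − ⟪B, aB⟫`.
* §3 THE SAME ON MATRIX FIELDS (p595460 ∕ p598821 kernel-formula letters `K_V` of `dcsE c ∘ dcE c`, `Q_V` of `QE D`, `H_V` of `hOp …`, `M_V` of `EE D − aE D w`):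
  ★★ `pairing_curlCurlExt_HExt` — `⟨X, K_V(H_V Dd)⟩_F = ⟨Q_V X, M_V Dd⟩_F`; ★★ `pairing_HExt_curlCurlExt_HExt` — `⟨H_V Dd, K_V(H_V Dd)⟩_F = ⟨Dd, M_V Dd⟩_F`
  (entrywise real readings, p620347 §1 `pairing_eq_sum_entries`, p608822 `toLp_re_reading_extension`); `HExt_mem_lieSU` (`H_V` of an 𝔰𝔲(N)-valued datum is 𝔰𝔲(N)-valued).
* §4 `inner_hessOpAt_sub_sub` — the chart algebra `½⟪A′ − W, Δ(A′ − W)⟫ = ½⟪A′, ΔA′⟫ − ⟪A′, ΔW⟫ + ½⟪W, ΔW⟫` for S1's symmetric `Δ_{U₀}` (any background).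
* §5 ★★★ `wilsonAction4_expChart_one_chart_eq157` — **(157)**: for `A′ ∈ TangentBondSU P 0 N`, an 𝔰𝔲(N)-valued block datum `Dd` and `W` with `⇑W = H_V ⇑Dd`:
  `𝔄(exp(A′ − W)) = ½⟪A′, Δ_1A′⟫ + (N·c²)⁻¹·(½⟨Dd, M_V Dd⟩_F − ⟨Q_V ⇑A′, M_V Dd⟩_F) + Σ_p Re ρ_p(A_{A′−W})` (p624107's Riesz factor `(N·c²)⁻¹`).
* §6 (v1.1) ★★★ `wilsonAction4_expChart_one_chart_eq157_gauge` — the SAME identity for `⇑W = H_V ⇑Dd + (b ↦ μ(b₊) − μ(b₋))` (Landau `H` MODULO A PURE GAUGE = the route's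
  comb-corrected right inverse of the TRUE linearised averaging, k0-s1-w1 `…RecordAveragingRightInverse`): the gauge part is `Δ_1`-invisible (p624107 (hK) + symmetry).
HONEST SCOPE.  Algebra over kernel-checked identities (S1, UST `FlatCubeOperators`∕`FlatHCurlCurl`, lit-balaban V1, pv27); NO estimate; `D = Dfun A′` (S2's chart map) and
the (98)-slot bounds on `W = (δ∕δA′)V` (S4b) are NOT here; the normalisation dictionary to S4b's `τ`-pairings `BE`∕`B` ((27): `η^d·Σ τ(Y δ)`) is one displayed factor
(p598821 `bondPair_PBond_eq_sum`, S1 `re_bondPair_hermLetter`) and is left to the consumer; nothing of Bałaban's analysis asserted; `stub_prop8StepCoP13` ∕ K0⁷ ∕ K1⁹ NOT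
closed; N07 NOT discharged; counts unmoved (28∕28 · 5∕27); one finite 𝕋⁴ programme at fixed ε — R4 closes the conditional finite-𝕋⁴ rung `BalabanLadder.UV` only, never the
summit; the YM mass gap (Clay) is NOT proved by any of this; nothing continuum ∕ ℝ⁴ ∕ OS.  No `sorry`, no `def`, no `instance`, no `notation`.

References: [15] (26)–(27) p.282, (45)–(47) p.285, (127)–(129) p.297, (137) p.298, (153) p.301, (157)–(158) p.302; [5] (3.10)–(3.12) p.392; [B6] (2.19)–(2.22) p.226,
(2.34)–(2.35) p.228.
-/

set_option autoImplicit false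
noncomputable section
open scoped BigOperators Matrix InnerProductSpace RealInnerProductSpace Matrix.Norms.L2Operator

namespace Summit.QuantumFields.YangMills.BalabanUVNodes.N07Eq157ActionInChartCoordinates

open Literature.MathematicalPhysics.QuantumFieldTheory.Balaban1983to89
open Literature.MathematicalPhysics.QuantumFieldTheory.Balaban1983to89.Node00
open Literature.MathematicalPhysics.QuantumFieldTheory.BalabanImbrieJaffe1984to88.BIJ85AxialPropagator411 (BondSpace)
open T4AdjointCovarianceUnitary (lieSU)
open B9Eq39Adjoint (bondPair rem3 posPlaq)
open B9TorusCalculus (torusT)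
open B12Eq18Current (dirForm)
open B10Eq68TorusRegularity (covDivT)
open B6SectADomainsV1 (Domains)
open B6SectAOperatorsV1 (BondIdx BondIdxSpace QE QsE aE dcE dcsE inner_QsE_left inner_dcsE_left inner_eq_sum)
open B6SectAVectorModelV1 (GE EE)
open B6SectA (hOp)
open Summit.QuantumFields.YangMills.Theorems.FlatCubeOperators (QE_hOp)
open Summit.QuantumFields.YangMills.Theorems.FlatHCurlCurl (curlCurl_hOp)
open Summit.QuantumFields.YangMills.Theorems.K0Stub1H128OfRecordCriticality (pairing_eq_sum_entries exists_entryCLM)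
open Summit.QuantumFields.YangMills.Theorems.K0Stub1CurlCurlRowOfEq158 (toLp_re_reading_extension)
open Summit.QuantumFields.YangMills.BalabanUVNodes.N07SectBExpansionAtObjects (J_torusT_cfgGL_eq_imPart_covDivT wilsonAction4_expChart_expansion_hessOpAt)
open Summit.QuantumFields.YangMills.BalabanUVNodes.N07FlatHessianCurlCurlAdapter (pairing_hessOpAt_one_eq sum_re_trace_eq_inner inner_hessOpAt_one_pureGauge_eq_zero)

variable {P : Params} {N : ℕ} {j : ℕ} [NeZero N]

/-! ## §1  The flat (26): `J(1) = 0`, `𝔄(1) = 0` -/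

/-- The general-linear datum of record of the trivial `SU(N)` configuration is the trivial datum. [cite: Balaban1985BackgroundPropagators, p.392 (bookkeeping)] -/
theorem cfgGL_one : cfgGL N (1 : GaugeField P j (SU N)) = fun _ => 1 := by
  funext b
  ext
  rfl

/-- **THE CURRENT OF (28) VANISHES AT THE FLAT BACKGROUND**: `J(1) = η⁻²·Im D^{η*}_1∂1 = 0` (`B10Eq68TorusRegularity.covDivT_one`). [cite: Balaban1985Variational, (28) p.282] -/
theorem J_cfgGL_one (η : ℝ) :
    B9Eq39Adjoint.J (torusT P j) (dirForm (cfgGL N (1 : GaugeField P j (SU N)))) η = fun _ _ => 0 := by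
  funext μ x
  rw [J_torusT_cfgGL_eq_imPart_covDivT, cfgGL_one, B10Eq68TorusRegularity.covDivT_one]
  simp [B11Eq27Current.imPart]

omit [NeZero N] in
/-- pv27's bond pairing against the zero field vanishes. [cite: Balaban1985BackgroundPropagators, (3.11) p.392] -/
theorem bondPair_zero_right {S ι 𝔸 : Type*} [Fintype S] [Fintype ι] [NormedRing 𝔸] [NormedAlgebra ℂ 𝔸] (η : ℝ) (d : ℕ) (τ : 𝔸 →ₗ[ℂ] ℂ)
    (A : ι → S → 𝔸) : bondPair η d τ A (fun _ _ => 0) = 0 := by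
  unfold bondPair
  simp

/-- ★★ **THE FLAT (26)**: `𝔄(exp X) = ½⟪X, Δ_1X⟫ + Σ_p Re ρ_p(A_X)`, `A_X = hermLetter η 1 X` — dag-n07-w1 g0's `wilsonAction4_expChart_expansion_hessOpAt` at `U₀ = 1`, where
`𝔄(1) = 0` and the first-order term `⟨A_X, J(1)⟩` vanishes. [cite: Balaban1985Variational, (26) p.282, (157) p.302; Balaban1985BackgroundPropagators, (3.10)-(3.12) p.392] -/
theorem wilsonAction4_expChart_one_expansion_hessOpAt {η : ℝ} (hη : η ≠ 0) (X : TangentBondSU P j N) :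
    wilsonAction4 (expChart (1 : GaugeField P j (SU N)) X) =
      2⁻¹ * ⟪X, hessOpAt η (1 : GaugeField P j (SU N)) X⟫_ℝ
        + (∑ q ∈ posPlaq (Site P j) (Fin P.d), rem3 (torusT P j) (dirForm (cfgGL N (1 : GaugeField P j (SU N)))) η
            ((N : ℂ)⁻¹ • Matrix.traceLinearMap (Fin N) ℂ ℂ) (hermLetter η 1 X) q.2.1 q.2.2 q.1).re := by
  rw [wilsonAction4_expChart_expansion_hessOpAt hη, N07AvoidanceAtFlatData.wilsonAction4_one, J_cfgGL_one, bondPair_zero_right, Complex.zero_re, add_zero, zero_add]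

/-! ## §2  The operator letters: `⟪x, ∂*∂(HB)⟫ = ⟪Qx, ((QGQ*)⁻¹ − a)B⟫` -/

section Letters

omit [NeZero N]
variable (D : Domains P) {c : ℝ} (hc : c ≠ 0) {w : BondIdx D → ℝ} (hw : ∀ i, 0 < w i)

/-- ★ **(137) IN THE PAIRING** ([15] p.298 «we have used the equality RD*H = 0»): for EVERY fine field `x` and block datum `B`,
`⟪x, ∂*∂(HB)⟫ = ⟪Qx, (QGQ*)⁻¹B⟫ − ⟪Qx, aB⟫` — UST's operator identity `curlCurl_hOp` read through `⟪x, Q*ω⟫ = ⟪Qx, ω⟫`. [cite: Balaban1985Variational, (137) p.298, (157) p.302; Balaban1984PropagatorsII, (2.19) p.226, (2.35) p.228] -/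
theorem inner_curlCurl_hOp (x : BondSpace P) (B : BondIdxSpace D) :
    ⟪x, (dcsE c ∘ₗ dcE c) (hOp (GE D hc hw) (QsE D) (EE D hc hw) B)⟫_ℝ = ⟪QE D x, EE D hc hw B⟫_ℝ - ⟪QE D x, aE D w B⟫_ℝ := by
  have key : ∀ ω : BondIdxSpace D, ⟪x, QsE D ω⟫_ℝ = ⟪QE D x, ω⟫_ℝ := fun ω => by
    rw [← real_inner_comm, inner_QsE_left]
    exact real_inner_comm _ _
  rw [LinearMap.comp_apply, curlCurl_hOp D hc hw B, inner_sub_right, key, key]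

/-- ★ `⟪HB, ∂*∂(HB)⟫ = ⟪B, (QGQ*)⁻¹B⟫ − ⟪B, aB⟫` (`QH = 1`). [cite: Balaban1985Variational, (157) p.302; Balaban1984PropagatorsII, (2.35) p.228] -/
theorem inner_hOp_curlCurl_hOp (B : BondIdxSpace D) :
    ⟪hOp (GE D hc hw) (QsE D) (EE D hc hw) B, (dcsE c ∘ₗ dcE c) (hOp (GE D hc hw) (QsE D) (EE D hc hw) B)⟫_ℝ =
      ⟪B, EE D hc hw B⟫_ℝ - ⟪B, aE D w B⟫_ℝ := by
  rw [inner_curlCurl_hOp D hc hw, QE_hOp]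

end Letters

/-! ## §3  The letters on matrix fields (kernel-formula extensions) -/

section MatrixFields

omit [NeZero N]
variable (D : Domains P) {c : ℝ} (hc : c ≠ 0) {w : BondIdx D → ℝ} (hw : ∀ i, 0 < w i)

/-- `Im z = Re((−I)·z)`. [folklore] -/
private theorem im_eq_re_neg_I_mul (z : ℂ) : z.im = (-Complex.I * z).re := by
  simp [Complex.mul_re]

/-- ★★ **`⟨X, K_V(H_V Dd)⟩_F = ⟨Q_V X, M_V Dd⟩_F`** for all matrix fields `X` (fine) and `Dd` (block data): §2 entry by entry.
[cite: Balaban1985Variational, (137) p.298, (157) p.302; Balaban1984PropagatorsII, (2.19) p.226, (2.35) p.228] -/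
theorem pairing_curlCurlExt_HExt {instDE : DecidableEq (PBond P 0)} {instDB : DecidableEq (BondIdx D)}
    {KV : (PBond P 0 → Matrix (Fin N) (Fin N) ℂ) →ₗ[ℂ] (PBond P 0 → Matrix (Fin N) (Fin N) ℂ)}
    {QV : (PBond P 0 → Matrix (Fin N) (Fin N) ℂ) →ₗ[ℂ] (BondIdx D → Matrix (Fin N) (Fin N) ℂ)}
    {HV : (BondIdx D → Matrix (Fin N) (Fin N) ℂ) →ₗ[ℂ] (PBond P 0 → Matrix (Fin N) (Fin N) ℂ)}
    {MV : (BondIdx D → Matrix (Fin N) (Fin N) ℂ) →ₗ[ℂ] (BondIdx D → Matrix (Fin N) (Fin N) ℂ)}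
    (hKV : ∀ (A : PBond P 0 → Matrix (Fin N) (Fin N) ℂ) (b : PBond P 0),
      KV A b = ∑ j, ((WithLp.ofLp ((dcsE c ∘ₗ dcE c) (WithLp.toLp 2 (Pi.single j 1))) b : ℝ) : ℂ) • A j)
    (hQV : ∀ (A : PBond P 0 → Matrix (Fin N) (Fin N) ℂ) (t : BondIdx D),
      QV A t = ∑ j, ((WithLp.ofLp (QE D (WithLp.toLp 2 (Pi.single j 1))) t : ℝ) : ℂ) • A j)
    (hHV : ∀ (X : BondIdx D → Matrix (Fin N) (Fin N) ℂ) (b : PBond P 0),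
      HV X b = ∑ t, ((WithLp.ofLp (hOp (GE D hc hw) (QsE D) (EE D hc hw) (WithLp.toLp 2 (Pi.single t 1))) b : ℝ) : ℂ) • X t)
    (hMV : ∀ (X : BondIdx D → Matrix (Fin N) (Fin N) ℂ) (t : BondIdx D),
      MV X t = ∑ s, ((WithLp.ofLp ((EE D hc hw - aE D w) (WithLp.toLp 2 (Pi.single s 1))) t : ℝ) : ℂ) • X s)
    (X : PBond P 0 → Matrix (Fin N) (Fin N) ℂ) (Dd : BondIdx D → Matrix (Fin N) (Fin N) ℂ) :
    ∑ b, ((X b)ᴴ * KV (HV Dd) b).trace.re = ∑ t, ((QV X t)ᴴ * MV Dd t).trace.re := by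
  rw [pairing_eq_sum_entries, pairing_eq_sum_entries]
  refine Finset.sum_congr rfl fun j' _ => Finset.sum_congr rfl fun i _ => ?_
  obtain ⟨φ, hφ⟩ := exists_entryCLM (N := N) j' i
  have hψ : ∀ Y : Matrix (Fin N) (Fin N) ℂ, ((-Complex.I) • φ) Y = -Complex.I * Y j' i := fun Y => by
    show -Complex.I • φ Y = _; rw [hφ, smul_eq_mul]
  -- readings of the four extensions
  have hKre : ∀ A : PBond P 0 → Matrix (Fin N) (Fin N) ℂ,
      WithLp.toLp 2 (fun b => (KV A b j' i).re) = (dcsE c ∘ₗ dcE c) (WithLp.toLp 2 (fun b => (A b j' i).re)) := fun A => by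
    simpa only [hφ] using toLp_re_reading_extension (dcsE c ∘ₗ dcE c) (A := A) (𝔄 := KV A) (fun b => hKV A b) φ
  have hKim : ∀ A : PBond P 0 → Matrix (Fin N) (Fin N) ℂ,
      WithLp.toLp 2 (fun b => (KV A b j' i).im) = (dcsE c ∘ₗ dcE c) (WithLp.toLp 2 (fun b => (A b j' i).im)) := fun A => by
    simpa only [hψ, ← im_eq_re_neg_I_mul] using toLp_re_reading_extension (dcsE c ∘ₗ dcE c) (A := A) (𝔄 := KV A) (fun b => hKV A b) ((-Complex.I) • φ)
  have hHre : WithLp.toLp 2 (fun b => (HV Dd b j' i).re) = hOp (GE D hc hw) (QsE D) (EE D hc hw) (WithLp.toLp 2 (fun t => (Dd t j' i).re)) := by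
    simpa only [hφ] using toLp_re_reading_extension (hOp (GE D hc hw) (QsE D) (EE D hc hw)) (A := Dd) (𝔄 := HV Dd) (fun b => hHV Dd b) φ
  have hHim : WithLp.toLp 2 (fun b => (HV Dd b j' i).im) = hOp (GE D hc hw) (QsE D) (EE D hc hw) (WithLp.toLp 2 (fun t => (Dd t j' i).im)) := by
    simpa only [hψ, ← im_eq_re_neg_I_mul] using
      toLp_re_reading_extension (hOp (GE D hc hw) (QsE D) (EE D hc hw)) (A := Dd) (𝔄 := HV Dd) (fun b => hHV Dd b) ((-Complex.I) • φ)
  have hQre : WithLp.toLp 2 (fun t => (QV X t j' i).re) = QE D (WithLp.toLp 2 (fun b => (X b j' i).re)) := by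
    simpa only [hφ] using toLp_re_reading_extension (QE D) (A := X) (𝔄 := QV X) (fun t => hQV X t) φ
  have hQim : WithLp.toLp 2 (fun t => (QV X t j' i).im) = QE D (WithLp.toLp 2 (fun b => (X b j' i).im)) := by
    simpa only [hψ, ← im_eq_re_neg_I_mul] using toLp_re_reading_extension (QE D) (A := X) (𝔄 := QV X) (fun t => hQV X t) ((-Complex.I) • φ)
  have hMre : WithLp.toLp 2 (fun t => (MV Dd t j' i).re) = (EE D hc hw - aE D w) (WithLp.toLp 2 (fun t => (Dd t j' i).re)) := by
    simpa only [hφ] using toLp_re_reading_extension (EE D hc hw - aE D w) (A := Dd) (𝔄 := MV Dd) (fun t => hMV Dd t) φ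
  have hMim : WithLp.toLp 2 (fun t => (MV Dd t j' i).im) = (EE D hc hw - aE D w) (WithLp.toLp 2 (fun t => (Dd t j' i).im)) := by
    simpa only [hψ, ← im_eq_re_neg_I_mul] using toLp_re_reading_extension (EE D hc hw - aE D w) (A := Dd) (𝔄 := MV Dd) (fun t => hMV Dd t) ((-Complex.I) • φ)
  rw [hKre, hKim, hHre, hHim, hQre, hQim, hMre, hMim, inner_curlCurl_hOp D hc hw, inner_curlCurl_hOp D hc hw]
  simp only [LinearMap.sub_apply, inner_sub_right]

/-- ★★ **`⟨H_V Dd, K_V(H_V Dd)⟩_F = ⟨Dd, M_V Dd⟩_F`** (`QH = 1` on top of the previous theorem). [cite: Balaban1985Variational, (157) p.302; Balaban1984PropagatorsII, (2.35) p.228] -/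
theorem pairing_HExt_curlCurlExt_HExt {instDE : DecidableEq (PBond P 0)} {instDB : DecidableEq (BondIdx D)}
    {KV : (PBond P 0 → Matrix (Fin N) (Fin N) ℂ) →ₗ[ℂ] (PBond P 0 → Matrix (Fin N) (Fin N) ℂ)}
    {QV : (PBond P 0 → Matrix (Fin N) (Fin N) ℂ) →ₗ[ℂ] (BondIdx D → Matrix (Fin N) (Fin N) ℂ)}
    {HV : (BondIdx D → Matrix (Fin N) (Fin N) ℂ) →ₗ[ℂ] (PBond P 0 → Matrix (Fin N) (Fin N) ℂ)}
    {MV : (BondIdx D → Matrix (Fin N) (Fin N) ℂ) →ₗ[ℂ] (BondIdx D → Matrix (Fin N) (Fin N) ℂ)}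
    (hKV : ∀ (A : PBond P 0 → Matrix (Fin N) (Fin N) ℂ) (b : PBond P 0),
      KV A b = ∑ j, ((WithLp.ofLp ((dcsE c ∘ₗ dcE c) (WithLp.toLp 2 (Pi.single j 1))) b : ℝ) : ℂ) • A j)
    (hQV : ∀ (A : PBond P 0 → Matrix (Fin N) (Fin N) ℂ) (t : BondIdx D),
      QV A t = ∑ j, ((WithLp.ofLp (QE D (WithLp.toLp 2 (Pi.single j 1))) t : ℝ) : ℂ) • A j)
    (hHV : ∀ (X : BondIdx D → Matrix (Fin N) (Fin N) ℂ) (b : PBond P 0),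
      HV X b = ∑ t, ((WithLp.ofLp (hOp (GE D hc hw) (QsE D) (EE D hc hw) (WithLp.toLp 2 (Pi.single t 1))) b : ℝ) : ℂ) • X t)
    (hMV : ∀ (X : BondIdx D → Matrix (Fin N) (Fin N) ℂ) (t : BondIdx D),
      MV X t = ∑ s, ((WithLp.ofLp ((EE D hc hw - aE D w) (WithLp.toLp 2 (Pi.single s 1))) t : ℝ) : ℂ) • X s)
    (Dd : BondIdx D → Matrix (Fin N) (Fin N) ℂ) :
    ∑ b, ((HV Dd b)ᴴ * KV (HV Dd) b).trace.re = ∑ t, ((Dd t)ᴴ * MV Dd t).trace.re := by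
  rw [pairing_curlCurlExt_HExt D hc hw hKV hQV hHV hMV (HV Dd) Dd]
  -- `Q_V (H_V Dd) = Dd` entrywise (`QH = 1`)
  have hQH : QV (HV Dd) = Dd := by
    funext t
    ext j' i
    obtain ⟨φ, hφ⟩ := exists_entryCLM (N := N) j' i
    have hψ : ∀ Y : Matrix (Fin N) (Fin N) ℂ, ((-Complex.I) • φ) Y = -Complex.I * Y j' i := fun Y => by
      show -Complex.I • φ Y = _; rw [hφ, smul_eq_mul]
    have hQre : WithLp.toLp 2 (fun t => (QV (HV Dd) t j' i).re) = QE D (WithLp.toLp 2 (fun b => (HV Dd b j' i).re)) := by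
      simpa only [hφ] using toLp_re_reading_extension (QE D) (A := HV Dd) (𝔄 := QV (HV Dd)) (fun t => hQV (HV Dd) t) φ
    have hQim : WithLp.toLp 2 (fun t => (QV (HV Dd) t j' i).im) = QE D (WithLp.toLp 2 (fun b => (HV Dd b j' i).im)) := by
      simpa only [hψ, ← im_eq_re_neg_I_mul] using toLp_re_reading_extension (QE D) (A := HV Dd) (𝔄 := QV (HV Dd)) (fun t => hQV (HV Dd) t) ((-Complex.I) • φ)
    have hHre : WithLp.toLp 2 (fun b => (HV Dd b j' i).re) = hOp (GE D hc hw) (QsE D) (EE D hc hw) (WithLp.toLp 2 (fun t => (Dd t j' i).re)) := by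
      simpa only [hφ] using toLp_re_reading_extension (hOp (GE D hc hw) (QsE D) (EE D hc hw)) (A := Dd) (𝔄 := HV Dd) (fun b => hHV Dd b) φ
    have hHim : WithLp.toLp 2 (fun b => (HV Dd b j' i).im) = hOp (GE D hc hw) (QsE D) (EE D hc hw) (WithLp.toLp 2 (fun t => (Dd t j' i).im)) := by
      simpa only [hψ, ← im_eq_re_neg_I_mul] using
        toLp_re_reading_extension (hOp (GE D hc hw) (QsE D) (EE D hc hw)) (A := Dd) (𝔄 := HV Dd) (fun b => hHV Dd b) ((-Complex.I) • φ)
    rw [hHre, QE_hOp] at hQre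
    rw [hHim, QE_hOp] at hQim
    have hre : (QV (HV Dd) t j' i).re = (Dd t j' i).re := by
      have := congrArg (fun v => (WithLp.ofLp v) t) hQre
      simpa using this
    have him : (QV (HV Dd) t j' i).im = (Dd t j' i).im := by
      have := congrArg (fun v => (WithLp.ofLp v) t) hQim
      simpa using this
    exact Complex.ext hre him
  rw [hQH]

/-- `H_V` of an 𝔰𝔲(N)-valued block datum is 𝔰𝔲(N)-valued (the kernel is real). [cite: Balaban1984PropagatorsII, (2.35) p.228] -/
theorem HExt_mem_lieSU {instDB : DecidableEq (BondIdx D)}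
    {HV : (BondIdx D → Matrix (Fin N) (Fin N) ℂ) →ₗ[ℂ] (PBond P 0 → Matrix (Fin N) (Fin N) ℂ)}
    (hHV : ∀ (X : BondIdx D → Matrix (Fin N) (Fin N) ℂ) (b : PBond P 0),
      HV X b = ∑ t, ((WithLp.ofLp (hOp (GE D hc hw) (QsE D) (EE D hc hw) (WithLp.toLp 2 (Pi.single t 1))) b : ℝ) : ℂ) • X t)
    {Dd : BondIdx D → Matrix (Fin N) (Fin N) ℂ} (hDd : ∀ t, Dd t ∈ lieSU (Fin N)) (b : PBond P 0) : HV Dd b ∈ lieSU (Fin N) := by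
  rw [hHV]
  refine Submodule.sum_mem _ fun t _ => ?_
  rw [Complex.coe_smul]
  exact Submodule.smul_mem _ _ (hDd t)

end MatrixFields

/-! ## §4  The chart algebra for S1's symmetric Hessian -/

omit [NeZero N] in
/-- `½⟪A′ − W, Δ(A′ − W)⟫ = ½⟪A′, ΔA′⟫ − ⟪A′, ΔW⟫ + ½⟪W, ΔW⟫` for the symmetric operator `Δ_{U₀} = hessOpAt η U₀` (any background).
[cite: Balaban1985Variational, (47) p.285, (157) p.302] -/
theorem inner_hessOpAt_sub_sub (η : ℝ) (U₀ : GaugeField P j (SU N)) (A W : TangentBondSU P j N) :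
    2⁻¹ * ⟪A - W, hessOpAt η U₀ (A - W)⟫_ℝ = 2⁻¹ * ⟪A, hessOpAt η U₀ A⟫_ℝ - ⟪A, hessOpAt η U₀ W⟫_ℝ + 2⁻¹ * ⟪W, hessOpAt η U₀ W⟫_ℝ := by
  have hsymm : ⟪W, hessOpAt η U₀ A⟫_ℝ = ⟪A, hessOpAt η U₀ W⟫_ℝ := by
    rw [← hessOpAt_isSymmetric η U₀ A W, real_inner_comm]
  rw [map_sub, inner_sub_left, inner_sub_right, inner_sub_right, hsymm]
  ring

/-! ## §5  (157): the action in the chart coordinates -/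

section Eq157

variable (D : Domains P) {c : ℝ} (hc : c ≠ 0) {w : BondIdx D → ℝ} (hw : ∀ i, 0 < w i)

/-- ★★★ **[15] (157) AT NODE 00's RECORD OPERATORS.**  For lit-balaban's flat operators of ANY nested family `D` read on matrix fields by their kernel formulas
(`K_V` of `∂*∂ = dcsE c ∘ dcE c`, `Q_V` of `QE D`, `H_V` of `H = hOp (GE D) (QsE D) (EE D)`, `M_V` of `(QGQ*)⁻¹ − a = EE D − aE D w`), every `A′ ∈ TangentBondSU P 0 N`, every
𝔰𝔲(N)-valued block datum `Dd` and the tangent vector `W` with `⇑W = H_V ⇑Dd` (print's `HD(A′)` once `Dd = D(A′)` is S2's chart map):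
**`𝔄(exp(A′ − W)) = ½⟪A′, Δ_1A′⟫ + (N·c²)⁻¹·(½⟨Dd, M_V Dd⟩_F − ⟨Q_V ⇑A′, M_V Dd⟩_F) + Σ_p Re ρ_p(A_{A′−W})`** — print's
`½⟨A′, Δ(1)A′⟩ + ½⟨D, (QGQ*)⁻¹D⟩ − ⟨QA′, (QGQ*)⁻¹D⟩ − (a-terms) + V₀(A′ − HD)`, i.e. `½⟨A′, Δ(1)A′⟩ + V(A′)` with k0-s1-w2's
`V = ½B(D, M_V·D) − B(QA′, M_V·D) + V₀(A′ − H·D)` in the Frobenius currency (`⟨X, Y⟩_F = Σ Re tr(XᴴY)`; S1's Riesz factor `(N·c²)⁻¹` displayed, p624107 `pairing_hessOpAt_one_eq`).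
[cite: Balaban1985Variational, (157) p.302, (47) p.285, (26) p.282, (137) p.298; Balaban1984PropagatorsII, (2.19) p.226, (2.35) p.228; Balaban1985BackgroundPropagators, (3.10)-(3.12) p.392] -/
theorem wilsonAction4_expChart_one_chart_eq157 {instDE : DecidableEq (PBond P 0)} {instDB : DecidableEq (BondIdx D)} {η : ℝ} (hη : η ≠ 0)
    {KV : (PBond P 0 → Matrix (Fin N) (Fin N) ℂ) →ₗ[ℂ] (PBond P 0 → Matrix (Fin N) (Fin N) ℂ)}
    {QV : (PBond P 0 → Matrix (Fin N) (Fin N) ℂ) →ₗ[ℂ] (BondIdx D → Matrix (Fin N) (Fin N) ℂ)}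
    {HV : (BondIdx D → Matrix (Fin N) (Fin N) ℂ) →ₗ[ℂ] (PBond P 0 → Matrix (Fin N) (Fin N) ℂ)}
    {MV : (BondIdx D → Matrix (Fin N) (Fin N) ℂ) →ₗ[ℂ] (BondIdx D → Matrix (Fin N) (Fin N) ℂ)}
    (hKV : ∀ (A : PBond P 0 → Matrix (Fin N) (Fin N) ℂ) (b : PBond P 0),
      KV A b = ∑ j, ((WithLp.ofLp ((dcsE c ∘ₗ dcE c) (WithLp.toLp 2 (Pi.single j 1))) b : ℝ) : ℂ) • A j)
    (hQV : ∀ (A : PBond P 0 → Matrix (Fin N) (Fin N) ℂ) (t : BondIdx D),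
      QV A t = ∑ j, ((WithLp.ofLp (QE D (WithLp.toLp 2 (Pi.single j 1))) t : ℝ) : ℂ) • A j)
    (hHV : ∀ (X : BondIdx D → Matrix (Fin N) (Fin N) ℂ) (b : PBond P 0),
      HV X b = ∑ t, ((WithLp.ofLp (hOp (GE D hc hw) (QsE D) (EE D hc hw) (WithLp.toLp 2 (Pi.single t 1))) b : ℝ) : ℂ) • X t)
    (hMV : ∀ (X : BondIdx D → Matrix (Fin N) (Fin N) ℂ) (t : BondIdx D),
      MV X t = ∑ s, ((WithLp.ofLp ((EE D hc hw - aE D w) (WithLp.toLp 2 (Pi.single s 1))) t : ℝ) : ℂ) • X s)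
    (A' W : TangentBondSU P 0 N) (Dd : BondIdx D → lieSU (Fin N))
    (hW : ∀ b, ((W b : lieSU (Fin N)) : Matrix (Fin N) (Fin N) ℂ) = HV (fun t => ((Dd t : lieSU (Fin N)) : Matrix (Fin N) (Fin N) ℂ)) b) :
    wilsonAction4 (expChart (1 : GaugeField P 0 (SU N)) (WithLp.ofLp (A' - W))) =
      2⁻¹ * ⟪A', hessOpAt η (1 : GaugeField P 0 (SU N)) A'⟫_ℝ
        + ((N : ℝ) * c ^ 2)⁻¹ *
          (2⁻¹ * ∑ t, ((((Dd t : lieSU (Fin N)) : Matrix (Fin N) (Fin N) ℂ))ᴴ *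
              MV (fun t => ((Dd t : lieSU (Fin N)) : Matrix (Fin N) (Fin N) ℂ)) t).trace.re
            - ∑ t, ((QV (fun b => ((A' b : lieSU (Fin N)) : Matrix (Fin N) (Fin N) ℂ)) t)ᴴ *
              MV (fun t => ((Dd t : lieSU (Fin N)) : Matrix (Fin N) (Fin N) ℂ)) t).trace.re)
        + (∑ q ∈ posPlaq (Site P 0) (Fin P.d), rem3 (torusT P 0) (dirForm (cfgGL N (1 : GaugeField P 0 (SU N)))) η
            ((N : ℂ)⁻¹ • Matrix.traceLinearMap (Fin N) ℂ ℂ) (hermLetter η 1 (A' - W)) q.2.1 q.2.2 q.1).re := by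
  -- the matrix field of `W` is `H_V ⇑Dd`
  have hWfun : (fun b => ((W b : lieSU (Fin N)) : Matrix (Fin N) (Fin N) ℂ)) = HV (fun t => ((Dd t : lieSU (Fin N)) : Matrix (Fin N) (Fin N) ℂ)) :=
    funext hW
  -- the cross term `⟪A′, Δ_1W⟫ = (N c²)⁻¹ ⟨Q_V ⇑A′, M_V Dd⟩_F`
  have hcross : ⟪A', hessOpAt η (1 : GaugeField P 0 (SU N)) W⟫_ℝ =
      ((N : ℝ) * c ^ 2)⁻¹ * ∑ t, ((QV (fun b => ((A' b : lieSU (Fin N)) : Matrix (Fin N) (Fin N) ℂ)) t)ᴴ *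
        MV (fun t => ((Dd t : lieSU (Fin N)) : Matrix (Fin N) (Fin N) ℂ)) t).trace.re := by
    rw [← sum_re_trace_eq_inner, pairing_hessOpAt_one_eq hη hc hKV, hWfun, pairing_curlCurlExt_HExt D hc hw hKV hQV hHV hMV]
  -- the square term `⟪W, Δ_1W⟫ = (N c²)⁻¹ ⟨Dd, M_V Dd⟩_F`
  have hsq : ⟪W, hessOpAt η (1 : GaugeField P 0 (SU N)) W⟫_ℝ =
      ((N : ℝ) * c ^ 2)⁻¹ * ∑ t, ((((Dd t : lieSU (Fin N)) : Matrix (Fin N) (Fin N) ℂ))ᴴ *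
        MV (fun t => ((Dd t : lieSU (Fin N)) : Matrix (Fin N) (Fin N) ℂ)) t).trace.re := by
    rw [← sum_re_trace_eq_inner, pairing_hessOpAt_one_eq hη hc hKV, hWfun]
    simp only [hW]
    rw [pairing_HExt_curlCurlExt_HExt D hc hw hKV hQV hHV hMV]
  rw [wilsonAction4_expChart_one_expansion_hessOpAt hη, inner_hessOpAt_sub_sub, hcross, hsq]
  ring

omit [NeZero N] in
/-- Currency note for the consumer: for a SKEW left factor (𝔰𝔲(N)-valued fields — `Q_V ⇑A′`, `Dd`, `M_V Dd` all are, the kernels being real) the Frobenius pairing is MINUS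
the real part of the bilinear trace pairing, `Σ_t Re tr((X t)ᴴ Y t) = −Re Σ_t tr(X t · Y t)` — the bridge to k0-s1-w2's `τ`-bilinear block pairing `B X X′ = Σ_t τ(X t · X′ t)`
(p598821 §1). [cite: Balaban1985Variational, (27) p.282, p.288; Balaban1985BackgroundPropagators, p.392 (X·Y = tr XY)] -/
theorem sum_re_trace_conjTranspose_mul_of_skew_left {ι : Type*} [Fintype ι] {X : ι → Matrix (Fin N) (Fin N) ℂ} (hX : ∀ t, (X t)ᴴ = -X t)
    (Y : ι → Matrix (Fin N) (Fin N) ℂ) : ∑ t, ((X t)ᴴ * Y t).trace.re = -(∑ t, (X t * Y t).trace).re := by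
  rw [Complex.re_sum, ← Finset.sum_neg_distrib]
  refine Finset.sum_congr rfl fun t _ => ?_
  rw [hX, Matrix.neg_mul, Matrix.trace_neg, Complex.neg_re]

end Eq157

/-! ## §6 (v1.1)  (157) for a right inverse that is Landau MODULO A PURE GAUGE — the route's comb-corrected `H` -/

section Eq157Gauge

variable (D : Domains P) {c : ℝ} (hc : c ≠ 0) {w : BondIdx D → ℝ} (hw : ∀ i, 0 < w i)

/-- ★★★ **(157) FOR `W = H_V Dd + ∂μ`** — the route's right inverse of the TRUE linearised averaging is lit-balaban's Landau `H` on re-indexed data PLUS the coarse pure gauge of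
the comb functional (k0-s1-w1 `…K0Stub1RecordAveragingRightInverse`: `HX = H₀X̃′ + ∂φ`; UST `ChartHInv.exists_rightInverse`); the pure-gauge part drops out of BOTH Hessian terms
(`⟪·, Δ_1(∂μ)⟫ = 0`: p624107 `inner_hessOpAt_one_pureGauge_eq_zero` + symmetry of `Δ_1`) and survives only inside `V₀`'s argument `A′ − W`:
**`𝔄(exp(A′ − W)) = ½⟪A′, Δ_1A′⟫ + (N·c²)⁻¹·(½⟨Dd, M_V Dd⟩_F − ⟨Q_V ⇑A′, M_V Dd⟩_F) + Σ_p Re ρ_p(A_{A′−W})`** for every `W ∈ TangentBondSU P 0 N` with `⇑W = H_V ⇑Dd + (b ↦ μ(b₊) − μ(b₋))`.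
[cite: Balaban1985Variational, (157) p.302, (45)-(47) p.285, (137) p.298; Balaban1984PropagatorsII, (2.35) p.228; Balaban1984PropagatorsI, (1.4) p.18, (1.20) p.20] -/
theorem wilsonAction4_expChart_one_chart_eq157_gauge {instDE : DecidableEq (PBond P 0)} {instDB : DecidableEq (BondIdx D)} {η : ℝ} (hη : η ≠ 0)
    {KV : (PBond P 0 → Matrix (Fin N) (Fin N) ℂ) →ₗ[ℂ] (PBond P 0 → Matrix (Fin N) (Fin N) ℂ)}
    {QV : (PBond P 0 → Matrix (Fin N) (Fin N) ℂ) →ₗ[ℂ] (BondIdx D → Matrix (Fin N) (Fin N) ℂ)}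
    {HV : (BondIdx D → Matrix (Fin N) (Fin N) ℂ) →ₗ[ℂ] (PBond P 0 → Matrix (Fin N) (Fin N) ℂ)}
    {MV : (BondIdx D → Matrix (Fin N) (Fin N) ℂ) →ₗ[ℂ] (BondIdx D → Matrix (Fin N) (Fin N) ℂ)}
    (hKV : ∀ (A : PBond P 0 → Matrix (Fin N) (Fin N) ℂ) (b : PBond P 0),
      KV A b = ∑ j, ((WithLp.ofLp ((dcsE c ∘ₗ dcE c) (WithLp.toLp 2 (Pi.single j 1))) b : ℝ) : ℂ) • A j)
    (hQV : ∀ (A : PBond P 0 → Matrix (Fin N) (Fin N) ℂ) (t : BondIdx D),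
      QV A t = ∑ j, ((WithLp.ofLp (QE D (WithLp.toLp 2 (Pi.single j 1))) t : ℝ) : ℂ) • A j)
    (hHV : ∀ (X : BondIdx D → Matrix (Fin N) (Fin N) ℂ) (b : PBond P 0),
      HV X b = ∑ t, ((WithLp.ofLp (hOp (GE D hc hw) (QsE D) (EE D hc hw) (WithLp.toLp 2 (Pi.single t 1))) b : ℝ) : ℂ) • X t)
    (hMV : ∀ (X : BondIdx D → Matrix (Fin N) (Fin N) ℂ) (t : BondIdx D),
      MV X t = ∑ s, ((WithLp.ofLp ((EE D hc hw - aE D w) (WithLp.toLp 2 (Pi.single s 1))) t : ℝ) : ℂ) • X s)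
    (A' W : TangentBondSU P 0 N) (Dd : BondIdx D → lieSU (Fin N)) (μ : Site P 0 → Matrix (Fin N) (Fin N) ℂ)
    (hW : ∀ b, ((W b : lieSU (Fin N)) : Matrix (Fin N) (Fin N) ℂ) =
      HV (fun t => ((Dd t : lieSU (Fin N)) : Matrix (Fin N) (Fin N) ℂ)) b + (μ b.tgt - μ b.src)) :
    wilsonAction4 (expChart (1 : GaugeField P 0 (SU N)) (WithLp.ofLp (A' - W))) =
      2⁻¹ * ⟪A', hessOpAt η (1 : GaugeField P 0 (SU N)) A'⟫_ℝ
        + ((N : ℝ) * c ^ 2)⁻¹ *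
          (2⁻¹ * ∑ t, ((((Dd t : lieSU (Fin N)) : Matrix (Fin N) (Fin N) ℂ))ᴴ *
              MV (fun t => ((Dd t : lieSU (Fin N)) : Matrix (Fin N) (Fin N) ℂ)) t).trace.re
            - ∑ t, ((QV (fun b => ((A' b : lieSU (Fin N)) : Matrix (Fin N) (Fin N) ℂ)) t)ᴴ *
              MV (fun t => ((Dd t : lieSU (Fin N)) : Matrix (Fin N) (Fin N) ℂ)) t).trace.re)
        + (∑ q ∈ posPlaq (Site P 0) (Fin P.d), rem3 (torusT P 0) (dirForm (cfgGL N (1 : GaugeField P 0 (SU N)))) η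
            ((N : ℂ)⁻¹ • Matrix.traceLinearMap (Fin N) ℂ ℂ) (hermLetter η 1 (A' - W)) q.2.1 q.2.2 q.1).re := by
  have hmem : ∀ b, HV (fun t => ((Dd t : lieSU (Fin N)) : Matrix (Fin N) (Fin N) ℂ)) b ∈ lieSU (Fin N) := fun b =>
    HExt_mem_lieSU D hc hw hHV (fun t => (Dd t).2) b
  let W₀ : TangentBondSU P 0 N := WithLp.toLp 2 fun b => ⟨_, hmem b⟩
  have hW₀ : ∀ b, ((W₀ b : lieSU (Fin N)) : Matrix (Fin N) (Fin N) ℂ) = HV (fun t => ((Dd t : lieSU (Fin N)) : Matrix (Fin N) (Fin N) ℂ)) b := fun b => rfl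
  have hG : ∀ b, (((W - W₀) b : lieSU (Fin N)) : Matrix (Fin N) (Fin N) ℂ) = μ b.tgt - μ b.src := fun b => by
    rw [PiLp.sub_apply, Submodule.coe_sub, hW, hW₀]; abel
  have hGA' : ⟪W - W₀, hessOpAt η (1 : GaugeField P 0 (SU N)) A'⟫_ℝ = 0 :=
    inner_hessOpAt_one_pureGauge_eq_zero hη (W - W₀) A' μ hG
  have hGA : ⟪A', hessOpAt η (1 : GaugeField P 0 (SU N)) (W - W₀)⟫_ℝ = 0 := by
    rw [← hessOpAt_isSymmetric η (1 : GaugeField P 0 (SU N)) A' (W - W₀)]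
    exact (real_inner_comm _ _).trans hGA'
  have hGW₀' : ⟪W - W₀, hessOpAt η (1 : GaugeField P 0 (SU N)) W₀⟫_ℝ = 0 :=
    inner_hessOpAt_one_pureGauge_eq_zero hη (W - W₀) W₀ μ hG
  have hGW₀ : ⟪W₀, hessOpAt η (1 : GaugeField P 0 (SU N)) (W - W₀)⟫_ℝ = 0 := by
    rw [← hessOpAt_isSymmetric η (1 : GaugeField P 0 (SU N)) W₀ (W - W₀)]
    exact (real_inner_comm _ _).trans hGW₀'
  have hGG : ⟪W - W₀, hessOpAt η (1 : GaugeField P 0 (SU N)) (W - W₀)⟫_ℝ = 0 :=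
    inner_hessOpAt_one_pureGauge_eq_zero hη (W - W₀) (W - W₀) μ hG
  have hWsplit : W = W₀ + (W - W₀) := by abel
  have hcrossW : ⟪A', hessOpAt η (1 : GaugeField P 0 (SU N)) W⟫_ℝ = ⟪A', hessOpAt η (1 : GaugeField P 0 (SU N)) W₀⟫_ℝ := by
    conv_lhs => rw [hWsplit]
    rw [map_add, inner_add_right, hGA, add_zero]
  have hsqW : ⟪W, hessOpAt η (1 : GaugeField P 0 (SU N)) W⟫_ℝ = ⟪W₀, hessOpAt η (1 : GaugeField P 0 (SU N)) W₀⟫_ℝ := by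
    conv_lhs => rw [hWsplit]
    rw [map_add, inner_add_left, inner_add_right, inner_add_right, hGW₀, hGG, hGW₀']
    ring
  have hW₀fun : (fun b => ((W₀ b : lieSU (Fin N)) : Matrix (Fin N) (Fin N) ℂ)) = HV (fun t => ((Dd t : lieSU (Fin N)) : Matrix (Fin N) (Fin N) ℂ)) :=
    funext hW₀
  have hcross : ⟪A', hessOpAt η (1 : GaugeField P 0 (SU N)) W₀⟫_ℝ =
      ((N : ℝ) * c ^ 2)⁻¹ * ∑ t, ((QV (fun b => ((A' b : lieSU (Fin N)) : Matrix (Fin N) (Fin N) ℂ)) t)ᴴ *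
        MV (fun t => ((Dd t : lieSU (Fin N)) : Matrix (Fin N) (Fin N) ℂ)) t).trace.re := by
    rw [← sum_re_trace_eq_inner, pairing_hessOpAt_one_eq hη hc hKV, hW₀fun, pairing_curlCurlExt_HExt D hc hw hKV hQV hHV hMV]
  have hsq : ⟪W₀, hessOpAt η (1 : GaugeField P 0 (SU N)) W₀⟫_ℝ =
      ((N : ℝ) * c ^ 2)⁻¹ * ∑ t, ((((Dd t : lieSU (Fin N)) : Matrix (Fin N) (Fin N) ℂ))ᴴ *
        MV (fun t => ((Dd t : lieSU (Fin N)) : Matrix (Fin N) (Fin N) ℂ)) t).trace.re := by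
    rw [← sum_re_trace_eq_inner, pairing_hessOpAt_one_eq hη hc hKV, hW₀fun]
    simp only [hW₀]
    rw [pairing_HExt_curlCurlExt_HExt D hc hw hKV hQV hHV hMV]
  rw [wilsonAction4_expChart_one_expansion_hessOpAt hη, inner_hessOpAt_sub_sub, hcrossW, hsqW, hcross, hsq]
  ring

end Eq157Gauge

end Summit.QuantumFields.YangMills.BalabanUVNodes.N07Eq157ActionInChartCoordinates
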